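import Summits.Schanuel.Schanuel.Theorems.DiophantineDichotomyApproximationPropertyCycleAPIOne
import Literature.NumberTheory.Transcendental.NesterenkoEliminationProp47Holds
import Literature.NumberTheory.Transcendental.PhilipponCriterionComponent
import Mathlib.RingTheory.Lasker
import HarnessLib

/-!
# Stub B `stub_smallPrimeCurve` of line `orbit-interpolation-determinant` (crux `ApproximationProperty`, stmt-Schanuel-6117)

Route `DiophantineDichotomy` (sub-problem `Schanuel/Schanuel`), crux
`Summit.Schanuel.Schanuel.Theses.DiophantineDichotomy.ApproximationProperty`, line
`orbit-interpolation-determinant`, skeleton v4, registered stub B `stub_smallPrimeCurve`: **a small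
irreducible plane curve**. From the box principle for ternary forms (stub A, taken as the hypothesis:
for `ω ∈ ℂ²`, `D ≥ 2`, `N ≥ 1` a non-zero form `P ∈ ℚ[x₀, x₁, x₂]` of degree `D` with
`1 ≤ |P| ≤ N`, `h(P) ≤ log N`, `|P(1, ω)| ≤ exp(c_A D − (D²/8) log(N+1))`) we produce, for
`Y ≥ Δ ≥ c = max(704, 16 (c_A + 16))`, a prime principal ideal `(Q)` of `ℚ[x₀, x₁, x₂]`, `Q` a form
of degree `a`, `1 ≤ a ≤ Δ`, `deg (Q) = a`, `h((Q)) ≤ 10 Y` and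
`log |(Q)(1, ω)| ≤ −(Δ/c) (Δ (h((Q)) + a) + Y a)`.

Proof (LNM 1752 Ch. 3 §4 throughout): with `D = ⌊Δ⌋`, `N = ⌊e^Y⌋` the form `P` of stub A generates
the homogeneous principal ideal `(P)`, unmixed of rank `2`
(`PhilipponMain.isUnmixedOfRank_span_singleton`), with `deg (P) = D`, `h((P)) ≤ h(P) + 4D ≤ Y + 4D`,
`|(P)(ω̄)| ≤ ‖P‖_ω̄ e^{8D} ≤ exp(c_A D − D²Y/8 + 8D)` (Prop. 4.8,
`NesterenkoPhilippon2001_ch3_prop_4_8_holds`). The weighted pigeonhole over Prop. 4.7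
(`PhilipponMain.exists_component_le_exp`, weights `Δ` and `Y + Δ`) applied to a minimal primary
decomposition (Lasker–Noether) selects a primary component whose radical `𝔭` has
`log |𝔭(ω̄)| ≤ −((U − 8D)/T)(Δ h(𝔭) + (Y + Δ) deg 𝔭)` with `U − 8D ≥ D²Y/16`, `T ≤ 11 ΔY`, whence the
ratio is `≥ Δ/704 ≥ Δ/c`. The associated prime `𝔭` of `(P)` is `(Q)` for a prime factor `Q ∣ P`
(`CycleAPIOne.exists_eq_span_prime_of_mem_associatedPrimes`), a form (`Roy2013.isHomogeneous_of_dvd`)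
with `deg (Q) = deg Q ≥ 1` (Prop. 4.8 1), `Literature.Barriers.Schanuel.one_le_ideg_of_isPrime`),
`deg (Q) ≤ deg (P) = D ≤ Δ` and `h((Q)) ≤ h((P)) + 4D ≤ Y + 8D ≤ 10Y` (Prop. 4.7 1), 2)).

Proofs only: no definitions, nothing asserted beyond the registered stub and private arithmetic.
Sources: Nesterenko, LNM 1752 (2001) Ch. 3 §4 Prop. 4.7, 4.8 (pp. 39–40); Philippon, Publ. Math.
IHÉS 64 (1986) §3 (the weighted choice of a prime component); Philippon, J. Number Theory 81 (2000)
(AP1 in `ℙ²`).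
-/

set_option linter.dupNamespace false

noncomputable section

namespace Summit.Schanuel.Schanuel.Cruxes.ApproximationProperty.OrbitInterpolationDeterminant

open Literature.NumberTheory.Transcendental.Nesterenko MvPolynomial Module
open Literature.NumberTheory.Transcendental (PhilipponMain.isUnmixedOfRank_span_singleton
  PhilipponMain.cons_one_ne_zero PhilipponMain.one_le_norm_cons_one
  PhilipponMain.exists_component_le_exp PhilipponMain.ideg_radical_le
  PhilipponMain.iheight_radical_le Roy2013.isHomogeneous_of_dvd)
open scoped BigOperators

namespace SmallPrimeCurve

/-! ## Real arithmetic of the weighted pigeonhole -/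

/-- The margin of the smallness exponent: with `Y ≥ c ≥ 16 (c_A + 16)` and `D ≥ 1`,
`D² Y/16 ≤ D² Y/8 − c_A D − 8D − 8D`. [folklore] -/
theorem margin_le {c cA Y D : ℝ} (hcA : 0 < cA) (hc16 : 16 * (cA + 16) ≤ c) (hcY : c ≤ Y)
    (hD1 : 1 ≤ D) :
    D ^ 2 / 16 * Y ≤ D ^ 2 / 8 * Y - cA * D - 8 * D - 8 * D := by
  have hY0 : 0 ≤ Y := by linarith
  have hD0 : 0 ≤ D := by linarith
  have e1 : 0 ≤ (D - 1) * Y := mul_nonneg (by linarith) hY0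
  have hDY : 16 * (cA + 16) ≤ D * Y := by nlinarith [e1]
  have e2 : 0 ≤ D * (D * Y - 16 * (cA + 16)) := mul_nonneg hD0 (by linarith)
  nlinarith [e2]

/-- The ratio of the pigeonhole: with `704 ≤ c`, `16 (c_A + 16) ≤ c ≤ Δ ≤ Y`, `2 ≤ D ≤ Δ ≤ 2D`,
`0 ≤ h ≤ Y + 4D`, one has `Δ/c ≤ (D²Y/8 − c_A D − 16 D)/(Δ (h + 4D) + (Y + Δ) D)`
(numerator `≥ D²Y/16`, denominator `≤ 11 ΔY`, `4D² ≥ Δ²`). [folklore] -/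
theorem ratio_le {c cA Δ Y D h : ℝ} (hcA : 0 < cA) (hc : 704 ≤ c) (hc16 : 16 * (cA + 16) ≤ c)
    (hcΔ : c ≤ Δ) (hΔY : Δ ≤ Y) (hD2 : 2 ≤ D) (hDΔ : D ≤ Δ) (hΔD : Δ ≤ 2 * D) (hh0 : 0 ≤ h)
    (hhY : h ≤ Y + 4 * D) :
    Δ / c ≤ (D ^ 2 / 8 * Y - cA * D - 8 * D - 8 * D) / (Δ * (h + 4 * D) + (Y + Δ) * D) := by
  have hc0 : 0 < c := by linarith
  have hΔ0 : 0 < Δ := by linarith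
  have hY0 : 0 < Y := by linarith
  have hD0 : 0 < D := by linarith
  have hT0 : 0 < Δ * (h + 4 * D) + (Y + Δ) * D := by positivity
  rw [div_le_div_iff₀ hc0 hT0]
  have e1 : 0 ≤ Δ * (Y + 4 * D - h) := mul_nonneg hΔ0.le (by linarith)
  have e2 : 0 ≤ Δ * (Y - D) := mul_nonneg hΔ0.le (by linarith)
  have e3 : 0 ≤ Y * (Δ - D) := mul_nonneg hY0.le (by linarith)
  have h1 : Δ * (h + 4 * D) + (Y + Δ) * D ≤ 11 * Δ * Y := by nlinarith [e1, e2, e3]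
  have h2 := margin_le hcA hc16 (hcΔ.trans hΔY) (by linarith : (1 : ℝ) ≤ D)
  have e4 : 0 ≤ (2 * D - Δ) * (2 * D + Δ) := mul_nonneg (by linarith) (by linarith)
  have e5 : 0 ≤ (4 * D ^ 2 - Δ ^ 2) * Y := mul_nonneg (by nlinarith [e4]) hY0.le
  calc Δ * (Δ * (h + 4 * D) + (Y + Δ) * D) ≤ Δ * (11 * Δ * Y) :=
        mul_le_mul_of_nonneg_left h1 hΔ0.le
    _ = 11 * Δ ^ 2 * Y := by ring
    _ ≤ 44 * D ^ 2 * Y := by nlinarith [e5]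
    _ = D ^ 2 / 16 * Y * 704 := by ring
    _ ≤ D ^ 2 / 16 * Y * c := mul_le_mul_of_nonneg_left hc (by positivity)
    _ ≤ (D ^ 2 / 8 * Y - cA * D - 8 * D - 8 * D) * c := mul_le_mul_of_nonneg_right h2 hc0.le

/-- Monotonicity of the weighted smallness in the ratio: `κ ≤ ρ`, `W ≥ 0` give
`e^{−ρ W} ≤ e^{−κ W}`. [folklore] -/
theorem exp_weight_mono {κ ρ W W' : ℝ} (hκρ : κ ≤ ρ) (hW : 0 ≤ W) (hW' : W' = W) :
    Real.exp (-ρ * W) ≤ Real.exp (-(κ * W')) := by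
  rw [Real.exp_le_exp, hW', neg_mul, neg_le_neg_iff]
  exact mul_le_mul_of_nonneg_right hκρ hW

end SmallPrimeCurve

/-! ## The stub -/

/-- **Stub B — a small irreducible plane curve.** Assume the box principle for ternary forms
(stub A). Then for `ω ∈ ℂ²` there is `c = c(ω) ≥ 1` (here `max(704, 16 (c_A(ω) + 16))`) such that
for `Y ≥ Δ ≥ c` some prime factor `Q` of the pigeonhole form of degree `⌊Δ⌋` and height `≤ e^Y`
generates a prime ideal `(Q)` of `ℚ[x₀, x₁, x₂]`, `Q` a form of degree `a = deg (Q)`, `1 ≤ a ≤ Δ`,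
`h((Q)) ≤ 10 Y`, and `|(Q)(1, ω)| ≤ exp(−(Δ/c)(Δ (h((Q)) + a) + Y a))` — LNM 1752 Ch. 3
Prop. 4.8 for `(P)`, the weighted pigeonhole over Prop. 4.7 (Philippon 1986 §3), and the
description of the associated primes of a principal ideal of the factorial ring `ℚ[x₀, x₁, x₂]`.
[cite: NesterenkoPhilippon2001, Ch. 3 Prop. 4.7, 4.8 (pp. 39–40); Ch. 4 §4 (p. 61)] -/
theorem stub_smallPrimeCurve :
    (∀ ω : Fin 2 → ℂ, ∃ c : ℝ, 0 < c ∧ ∀ D N : ℕ, 2 ≤ D → 1 ≤ N →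
      ∃ P : Rx 2, P ≠ 0 ∧ P.IsHomogeneous D ∧ 1 ≤ maxNorm P ∧ maxNorm P ≤ N ∧
        height P ≤ Real.log N ∧
        ‖aeval (Fin.cons 1 ω : Fin (2 + 1) → ℂ) P‖ ≤
          Real.exp (c * D - (D : ℝ) ^ 2 / 8 * Real.log ((N : ℝ) + 1))) →
    ∀ ω : Fin 2 → ℂ, ∃ c : ℝ, 1 ≤ c ∧ ∀ Δ Y : ℝ, c ≤ Δ → Δ ≤ Y →
      ∃ (Q : Rx 2) (a : ℕ), Q ≠ 0 ∧ Q.IsHomogeneous a ∧ 1 ≤ a ∧ (a : ℝ) ≤ Δ ∧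
        (Ideal.span {Q}).IsPrime ∧ ideg (Ideal.span {Q}) 2 = a ∧
        iheight (Ideal.span {Q}) 2 ≤ 10 * Y ∧
        iabs (Ideal.span {Q}) 2 (Fin.cons 1 ω) ≤
          Real.exp (-(Δ / c * (Δ * (iheight (Ideal.span {Q}) 2 + a) + Y * a))) := by
  letI := MvPolynomial.gradedAlgebra (σ := Fin (2 + 1)) (R := ℚ)
  intro hA ω
  obtain ⟨cA, hcA, hbox⟩ := hA ω
  -- the constant `c = max(704, 16 (c_A + 16))`
  set c : ℝ := max 704 (16 * (cA + 16)) with hcdef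
  have hc704 : (704 : ℝ) ≤ c := le_max_left _ _
  have hc16 : 16 * (cA + 16) ≤ c := le_max_right _ _
  have hc1 : (1 : ℝ) ≤ c := by linarith
  refine ⟨c, hc1, fun Δ Y hΔ hY => ?_⟩
  have hΔ0 : 0 ≤ Δ := by linarith
  have hY0 : 0 ≤ Y := by linarith
  have hYc : c ≤ Y := hΔ.trans hY
  -- the degree `D = ⌊Δ⌋ ≥ 2`
  set D : ℕ := ⌊Δ⌋₊ with hDdef
  have hD2 : 2 ≤ D := Nat.le_floor (by push_cast; linarith)
  have hD2R : (2 : ℝ) ≤ D := by exact_mod_cast hD2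
  have hDΔ : (D : ℝ) ≤ Δ := Nat.floor_le hΔ0
  have hΔD : Δ ≤ 2 * D := by
    have h1 : Δ < D + 1 := Nat.lt_floor_add_one Δ
    linarith
  -- the box height `N = ⌊e^Y⌋ ≥ 1`
  set N : ℕ := ⌊Real.exp Y⌋₊ with hNdef
  have hN1 : 1 ≤ N := Nat.le_floor (by push_cast; linarith [Real.add_one_le_exp Y])
  have hN1R : (1 : ℝ) ≤ N := by exact_mod_cast hN1
  have hNexp : (N : ℝ) ≤ Real.exp Y := Nat.floor_le (Real.exp_pos Y).le
  have hlogN : Real.log N ≤ Y := by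
    calc Real.log N ≤ Real.log (Real.exp Y) := Real.log_le_log (by linarith) hNexp
      _ = Y := Real.log_exp Y
  have hYlog : Y ≤ Real.log ((N : ℝ) + 1) := by
    have h1 : Real.exp Y < N + 1 := Nat.lt_floor_add_one (Real.exp Y)
    calc Y = Real.log (Real.exp Y) := (Real.log_exp Y).symm
      _ ≤ Real.log ((N : ℝ) + 1) := Real.log_le_log (Real.exp_pos Y) h1.le
  -- Dirichlet's box principle for ternary forms (stub A)
  obtain ⟨P, hP0, hPhom, hP1, -, hPht, hPval⟩ := hbox D N hD2 hN1
  have hω₁ : (Fin.cons 1 ω : Fin (2 + 1) → ℂ) ≠ 0 := PhilipponMain.cons_one_ne_zero ω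
  have hω₁1 : 1 ≤ ‖(Fin.cons 1 ω : Fin (2 + 1) → ℂ)‖ := PhilipponMain.one_le_norm_cons_one ω
  have hhtP : height P ≤ Y := hPht.trans hlogN
  -- `‖P(ω̄)‖ ≤ exp(c_A D − D² Y / 8)` and `‖P‖_ω̄ ≤ ‖P(ω̄)‖`
  have hPval' : ‖aeval (Fin.cons 1 ω : Fin (2 + 1) → ℂ) P‖ ≤
      Real.exp (cA * D - (D : ℝ) ^ 2 / 8 * Y) := by
    refine hPval.trans (Real.exp_le_exp.mpr ?_)
    have h0 : 0 ≤ (D : ℝ) ^ 2 / 8 := by positivity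
    linarith [mul_le_mul_of_nonneg_left hYlog h0]
  have hnorm : normAt (Fin.cons 1 ω) P ≤ Real.exp (cA * D - (D : ℝ) ^ 2 / 8 * Y) := by
    rw [normAt]
    refine (div_le_self (norm_nonneg _) ?_).trans hPval'
    exact one_le_mul_of_one_le_of_one_le hP1 (one_le_pow₀ hω₁1)
  -- the principal ideal `(P)`: homogeneous, unmixed of rank `2`; Proposition 4.8
  have hPu : ¬ IsUnit P := CycleAPIOne.not_isUnit_of_isHomogeneous hPhom hP0 (by omega)
  have hunm : IsUnmixedOfRank (Ideal.span {P}) 2 :=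
    PhilipponMain.isUnmixedOfRank_span_singleton hP0 hPu
  have hIhom : (Ideal.span {P}).IsHomogeneous (homogeneousSubmodule (Fin (2 + 1)) ℚ) := by
    refine Ideal.homogeneous_span _ _ fun x hx => ?_
    rw [Set.mem_singleton_iff] at hx
    subst hx
    exact ⟨D, hPhom⟩
  obtain ⟨hdeg, hht, habs⟩ :=
    NesterenkoPhilippon2001_ch3_prop_4_8_holds 2 P D (by norm_num) hP0 hPhom hunm _ hω₁
  have h2sq : ((2 : ℕ) : ℝ) ^ 2 = 4 := by norm_num
  have h2cb : ((2 : ℕ) : ℝ) ^ 3 = 8 := by norm_num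
  rw [h2sq] at hht habs
  have hh0 : 0 ≤ iheight (Ideal.span {P}) 2 := height_nonneg _
  have hhtI : iheight (Ideal.span {P}) 2 ≤ Y + 4 * D := by linarith
  -- the smallness exponent `U` and the weighted size `T` of `(P)`
  obtain ⟨U, hUdef⟩ : ∃ U : ℝ, U = (D : ℝ) ^ 2 / 8 * Y - cA * D - 8 * D := ⟨_, rfl⟩
  obtain ⟨Tw, hTwdef⟩ :
      ∃ Tw : ℝ, Tw = Δ * (iheight (Ideal.span {P}) 2 + 4 * D) + (Y + Δ) * D := ⟨_, rfl⟩
  have habsI : iabs (Ideal.span {P}) 2 (Fin.cons 1 ω) ≤ Real.exp (-U) := by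
    refine habs.trans ?_
    calc normAt (Fin.cons 1 ω) P * Real.exp (2 * 4 * D)
        ≤ Real.exp (cA * D - (D : ℝ) ^ 2 / 8 * Y) * Real.exp (2 * 4 * D) :=
          mul_le_mul_of_nonneg_right hnorm (Real.exp_pos _).le
      _ = Real.exp (-U) := by
          rw [← Real.exp_add, hUdef]
          congr 1
          ring
  have hTw : 0 < Tw := by
    rw [hTwdef]
    have e1 : 0 ≤ Δ * (iheight (Ideal.span {P}) 2 + 4 * D) := mul_nonneg hΔ0 (by linarith)
    have e2 : 0 < (Y + Δ) * D := mul_pos (by linarith) (by linarith)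
    linarith
  have hTle : Δ * (iheight (Ideal.span {P}) 2 + ((2 : ℕ) : ℝ) ^ 2 * (ideg (Ideal.span {P}) 2 : ℝ)) +
      (Y + Δ) * (ideg (Ideal.span {P}) 2 : ℝ) ≤ Tw := by
    rw [hTwdef, hdeg, h2sq]
  have hUle : ((2 : ℕ) : ℝ) ^ 3 * (ideg (Ideal.span {P}) 2 : ℝ) ≤ U := by
    rw [hdeg, h2cb, hUdef]
    have h2 := SmallPrimeCurve.margin_le hcA hc16 hYc (by linarith : (1 : ℝ) ≤ D)
    nlinarith [h2]
  have hρ : Δ / c ≤ (U - ((2 : ℕ) : ℝ) ^ 3 * (ideg (Ideal.span {P}) 2 : ℝ)) / Tw := by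
    rw [hdeg, h2cb, hUdef, hTwdef]
    exact SmallPrimeCurve.ratio_le hcA hc704 hc16 hΔ hY hD2R hDΔ hΔD hh0 hhtI
  -- a minimal primary decomposition of `(P)` and Proposition 4.7
  obtain ⟨T, hT⟩ := Submodule.IsLasker.exists_isMinimalPrimaryDecomposition
    (Submodule.isLasker (Rx 2) (Rx 2)) (Ideal.span {P})
  have h47 := NesterenkoPhilippon2001_ch3_prop_4_7_holds
  obtain ⟨hsum1, hsum2, -⟩ := h47 2 2 (Ideal.span {P}) (by norm_num) le_rfl hIhom hunm T hT _ hω₁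
  have hfacts := fun (Q : Ideal (Rx 2)) (hQ : Q ∈ T) =>
    Literature.Barriers.Schanuel.radical_component_facts hIhom hunm hT hQ
  have hk : ∀ Q ∈ T, 1 ≤ primaryExponent Q := fun Q hQ => (hfacts Q hQ).2.2.2.2
  -- the weighted pigeonhole: a small prime component `𝔭 = √Q'`
  obtain ⟨Q', hQ', hQ'le⟩ := PhilipponMain.exists_component_le_exp h47 (m := 2) (r := 2)
    (by norm_num) le_rfl hIhom hunm hT hω₁ hΔ0 hTw hTle hUle habsI
  obtain ⟨h𝔭prime, h𝔭hom, h𝔭unm, -, -⟩ := hfacts Q' hQ'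
  have h𝔭ass : Q'.radical ∈ (Ideal.span {P}).associatedPrimes := by
    have := hT.mem_associatedPrimes hQ'
    rwa [Submodule.colon_univ] at this
  have hdeg𝔭 := PhilipponMain.ideg_radical_le (r := 2) hsum1 hk hQ'
  have hht𝔭 := PhilipponMain.iheight_radical_le (r := 2) hsum2 hk hQ'
  rw [hdeg] at hdeg𝔭
  rw [hdeg, h2sq] at hht𝔭
  -- `𝔭 = (R)` for a prime factor `R` of `P`
  obtain ⟨R, hR, hRP, hRprime⟩ :=
    CycleAPIOne.exists_eq_span_prime_of_mem_associatedPrimes hP0 h𝔭ass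
  rw [hR] at h𝔭prime h𝔭hom h𝔭unm hQ'le hdeg𝔭 hht𝔭
  have hR0 : R ≠ 0 := hRprime.ne_zero
  have hRhom : R.IsHomogeneous R.totalDegree := Roy2013.isHomogeneous_of_dvd hPhom hP0 hRP
  obtain ⟨hdegR, -, -⟩ :=
    NesterenkoPhilippon2001_ch3_prop_4_8_holds 2 R R.totalDegree (by norm_num) hR0 hRhom h𝔭unm _ hω₁
  have ha1 : 1 ≤ ideg (Ideal.span {R}) 2 :=
    Literature.Barriers.Schanuel.one_le_ideg_of_isPrime NesterenkoPhilippon2001_ch3_prop_4_4_holds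
      (by norm_num) le_rfl h𝔭prime h𝔭hom h𝔭unm
  have hhR0 : 0 ≤ iheight (Ideal.span {R}) 2 := height_nonneg _
  rw [hdegR] at ha1 hdeg𝔭 hQ'le
  refine ⟨R, R.totalDegree, hR0, hRhom, ha1, ?_, h𝔭prime, hdegR, ?_, ?_⟩
  · -- `a ≤ D ≤ Δ`
    calc (R.totalDegree : ℝ) ≤ D := by exact_mod_cast hdeg𝔭
      _ ≤ Δ := hDΔ
  · -- `h((R)) ≤ h((P)) + 4D ≤ Y + 8D ≤ 10Y`
    linarith
  · -- the accuracy
    refine hQ'le.trans (SmallPrimeCurve.exp_weight_mono hρ (by positivity) ?_)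
    ring

end Summit.Schanuel.Schanuel.Cruxes.ApproximationProperty.OrbitInterpolationDeterminant

end
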